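import Summits.CriticalPhenomena.PercolationContinuityZ3.Theorems.PercNearOneGluingAdditiveGluingSetObserverUnfoldDefs
import HarnessLib

/-!
# Conjecture G / SET-W via a SET observer, XII: the pointwise unfolding identity (Lemma U-set, CLAIM) with a set-observer slot

Support file (`--supports stmt-CriticalPhenomena-4576`); no definitions, no named facts, no sorries.  Seat (b) V⁺-form `png-dp-vplus`, gen 13
(memo MEMO-gen12.md §4(b), §10 (U) of run/shared/lean/prim/prim-png-dp-vplus/).  Set-slot version of prim-ineq-prove-1's
`…NoHeavyLowerTailCSHLevelForms.lean`: pure algebra over the level forms `CSH.slForm` with the slot type `Option V` (slot `none` = the observer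
SET `O`, killed when it touches the avoided set; vertex slots `some u`), using the vocabulary `CSHSet.jnO / chiO / unfoldTO` of
`…SetObserverUnfoldDefs.lean`.
* `slForm_single_none`, `single_none_apply_nonneg/some` — the set slot has coefficient `δ_none` in every level form (it is never a decoy);
  stated for an arbitrary `DecidableEq (Option V)` instance so as to match the coefficient representation `CSH.slForm_eq_sum_single`.
* `jnO_insert`, `slStep_jnO`, **`slForm_jnO`** — THE POINTWISE CLAIM: for a symmetric transitive relation `R` and a decoy list whose decoys are
  vertex slots, `sl_L[jnO_S](s) = jnO_{S ∪ decoys}(s) − unfoldTO_S(L)(s) + unfoldK(L)(s)`; on the set slot the disjoint split is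
  `1{O ~ S ∪ {d}} = 1{O ~ S} + 1{O ~ d}·1{O ≁ S}·1{d ≁ S}` (the killed-observer rule `g_O(d;S)` of memo §3 appears by itself).
* `decoyListSet_heads`, `decoys_decoyListSet`, `decoyListSet_append`, `decoyListSet_heads_ne` — bookkeeping of the sub-system lists.
[cite: VandenbergHaggstromKahn2005, Thm. 1.3 (p. 6)] [cite: KozmaNitzan2024, Conj. 4 (p. 32)]
-/

noncomputable section

namespace Summit.CriticalPhenomena.PercolationContinuityZ3.Theorems

open MeasureTheory Set Literature.Probability.LatticeModels Literature.Probability.Percolation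
open scoped Classical

namespace CSHSet

open CSH HullPort

variable {V : Type*}

/-! ### The set slot has coefficient one; vertex slots do not read the set slot -/

/-- For a decoy list whose decoys are vertex slots, `sl_L[δ_none] = δ_none`: the set slot is never a decoy, so its value passes through
every level step unchanged and never enters another slot (stated for an arbitrary `DecidableEq` instance, to match the coefficient
representation `CSH.slForm_eq_sum_single`). [folklore] -/
theorem slForm_single_none (inst : DecidableEq (Option V)) (L : List (Option V × (Option V → ℝ))) (hL : ∀ dc ∈ L, ∃ d, dc.1 = some d)
    (a : ℝ) : slForm L (@Pi.single (Option V) (fun _ => ℝ) _ inst none a) = @Pi.single (Option V) (fun _ => ℝ) _ inst none a := by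
  induction L with
  | nil => rfl
  | cons dc L ih =>
    obtain ⟨d, hd⟩ := hL dc List.mem_cons_self
    have hstep : slStep dc (Pi.single none a : Option V → ℝ) = Pi.single none a := by
      funext s
      simp only [slStep, hd, Pi.single_apply]
      simp
    rw [slForm_cons_eq, hstep, ih (fun dc' hdc' => hL dc' (List.mem_cons_of_mem _ hdc'))]

/-- `δ_none(t) ≥ 0` (any `DecidableEq` instance). [folklore] -/
theorem single_none_apply_nonneg (inst : DecidableEq (Option V)) (t : Option V) :
    (0 : ℝ) ≤ @Pi.single (Option V) (fun _ => ℝ) _ inst none (1 : ℝ) t := by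
  cases t <;> simp

/-- `δ_none(some u) = 0` (any `DecidableEq` instance). [folklore] -/
theorem single_none_apply_some (inst : DecidableEq (Option V)) (u : V) :
    @Pi.single (Option V) (fun _ => ℝ) _ inst none (1 : ℝ) (some u) = 0 := by
  simp

/-! ### The pointwise unfolding identity with a set-observer slot (memo §4(b), CLAIM) -/

section Unfold

variable (R : V → V → Prop) (O : Finset V) (ℓ : ℝ)

/-- At a vertex decoy `jnO` is `J_S`: `jnO_S(some d) = 1 − ε_S(d)`. [folklore] -/
theorem jnO_some_eq_one_sub_av (S : Set V) (d : V) : jnO R O ℓ S (some d) = 1 - av R S d := by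
  rw [jnO_some, jn_eq_one_sub_av]

/-- **The disjoint split with a set observer**: `jnO_{S∪{d}} = jnO_S + chiO_S(d)·ε_S(d)`.  On the set slot this is
`ℓ·1{O ~ S ∪ {d}} = ℓ·1{O ~ S} + ℓ·1{O ~ d}·1{O ≁ S}·1{d ≁ S}` (transitivity of `R`: if `O ~ d` and `O ≁ S` then `d ≁ S`); on a vertex slot
it is `CSH.jn_insert`. (transcription of the cell memo png-dp-vplus MEMO-gen12.md §4(b)) [folklore] -/
theorem jnO_insert (hRs : ∀ a b, R a b → R b a) (hRt : ∀ a b c, R a b → R b c → R a c) (S : Set V) (d : V) (s : Option V) :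
    jnO R O ℓ (insert d S) s = jnO R O ℓ S s + chiO R O ℓ S d s * av R S d := by
  cases s with
  | some u => simp only [jnO_some, chiO_some]; exact jn_insert R hRs hRt S d u
  | none =>
    simp only [jnO_none, chiO_none]
    unfold CSH.av
    by_cases h1 : ∃ o ∈ O, ∃ s ∈ S, R o s
    · obtain ⟨o, ho, s, hs, hos⟩ := h1
      rw [if_pos ⟨o, ho, s, Set.mem_insert_of_mem _ hs, hos⟩, if_pos ⟨o, ho, s, hs, hos⟩,
        if_neg (fun h => h.2 o ho s hs hos)]
      ring
    · rw [if_neg h1]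
      have h1' : ∀ o ∈ O, ∀ s ∈ S, ¬ R o s := fun o ho s hs hos => h1 ⟨o, ho, s, hs, hos⟩
      by_cases h2 : ∃ o ∈ O, R o d
      · obtain ⟨o, ho, hod⟩ := h2
        rw [if_pos ⟨o, ho, d, Set.mem_insert _ _, hod⟩, if_pos ⟨⟨o, ho, hod⟩, h1'⟩,
          if_pos (fun s hs hds => h1' o ho s hs (hRt o d s hod hds))]
        ring
      · have h3 : ¬ ∃ o ∈ O, ∃ s ∈ insert d S, R o s := by
          rintro ⟨o, ho, s, hs, hos⟩
          rcases Set.mem_insert_iff.1 hs with rfl | hs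
          · exact h2 ⟨o, ho, hos⟩
          · exact h1 ⟨o, ho, s, hs, hos⟩
        have h4 : ¬ ((∃ o ∈ O, R o d) ∧ ∀ o ∈ O, ∀ s ∈ S, ¬ R o s) := fun h => h2 h.1
        rw [if_neg h3, if_neg h4]
        ring

/-- **One level step on `jnO_S` at a vertex decoy**: `jnO_S − c·jnO_S(some d) = jnO_{S∪{d}} − c − ε_S(d)·(chiO_S(d) − c)`.
(transcription of the cell memo png-dp-vplus MEMO-gen12.md §4(b), induction step of the CLAIM) [folklore] -/
theorem slStep_jnO (hRs : ∀ a b, R a b → R b a) (hRt : ∀ a b c, R a b → R b c → R a c) (S : Set V) (d : V) (c : Option V → ℝ) :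
    slStep (some d, c) (jnO R O ℓ S) = jnO R O ℓ (insert d S) - c - av R S d • (fun s' => chiO R O ℓ S d s' - c s') := by
  funext s
  simp only [slStep, Pi.sub_apply, Pi.smul_apply, smul_eq_mul]
  rw [jnO_insert R O ℓ hRs hRt S d s, jnO_some_eq_one_sub_av R O ℓ S d]
  ring

/-- **THE POINTWISE CLAIM OF LEMMA U-set** (memo §4(b)): for a symmetric transitive relation `R` and a decoy list whose decoys are vertex
slots, `sl_L[jnO_S](s) = jnO_{S ∪ decoys(L)}(s) − unfoldTO_S(L)(s) + unfoldK(L)(s)` — the remainder `CSH.unfoldK` is the configuration-free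
one of the point identity `CSH.slForm_jn`. (transcription of the cell memo png-dp-vplus MEMO-gen12.md §4(b), CLAIM) [folklore] -/
theorem slForm_jnO (hRs : ∀ a b, R a b → R b a) (hRt : ∀ a b c, R a b → R b c → R a c) (L : List (Option V × (Option V → ℝ)))
    (hL : ∀ dc ∈ L, ∃ d, dc.1 = some d) (S : Set V) (s : Option V) :
    slForm L (jnO R O ℓ S) s = jnO R O ℓ (S ∪ {d | some d ∈ L.map Prod.fst}) s - unfoldTO R O ℓ S L s + unfoldK L s := by
  induction L generalizing S s with
  | nil => simp [unfoldK]
  | cons dc L ih =>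
    obtain ⟨d, hd⟩ := hL dc List.mem_cons_self
    obtain ⟨d', c⟩ := dc
    simp only at hd
    subst hd
    have hL' : ∀ dc ∈ L, ∃ d, dc.1 = some d := fun dc hdc => hL dc (List.mem_cons_of_mem _ hdc)
    rw [slForm_cons_eq, slStep_jnO R O ℓ hRs hRt S d c, slForm_sub, slForm_sub, slForm_smul]
    simp only [Pi.sub_apply, Pi.smul_apply, smul_eq_mul, ih hL' (insert d S) s, unfoldTO_cons_some, unfoldK]
    have hset : insert d S ∪ {d'' | some d'' ∈ L.map Prod.fst} = S ∪ {d'' | some d'' ∈ ((some d, c) :: L).map Prod.fst} := by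
      ext a
      simp only [Set.mem_union, Set.mem_insert_iff, Set.mem_setOf_eq, List.map_cons, List.mem_cons, Option.some.injEq]
      tauto
    rw [hset]
    ring

end Unfold

/-! ### The sub-system lists -/

/-- The decoys of `decoyListSet w O A D` are vertex slots. [folklore] -/
theorem decoyListSet_heads (w : Sym2 V → unitInterval) (O : Finset V) (A : Set V) (D : List V) :
    ∀ dc ∈ decoyListSet w O A D, ∃ d, dc.1 = some d := fun dc hdc => by
  obtain ⟨d, _, hd⟩ := mem_decoyListSet w O A D dc hdc
  exact ⟨d, hd⟩

/-- The decoys of `decoyListSet w O A D` as a set of vertices: `{d | some d ∈ decoys} = {d | d ∈ D}`. [folklore] -/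
theorem decoys_decoyListSet (w : Sym2 V → unitInterval) (O : Finset V) :
    ∀ (A : Set V) (D : List V), {d : V | some d ∈ (decoyListSet w O A D).map Prod.fst} = {d | d ∈ D}
  | A, [] => by simp
  | A, d :: ds => by
    ext a
    have ih := decoys_decoyListSet w O (insert d A) ds
    have ih' : ∀ a', (some a' ∈ (decoyListSet w O (insert d A) ds).map Prod.fst) ↔ a' ∈ ds := fun a' => by
      have := congrArg (fun s : Set V => a' ∈ s) ih
      simpa using this
    simp only [decoyListSet_cons, List.map_cons, List.mem_cons, Option.some.injEq, Set.mem_setOf_eq, ih']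

/-- **The decoy/constant list with a set slot splits along the decoy list** (set version of `CSH.decoyList_append`). [folklore] -/
theorem decoyListSet_append (w : Sym2 V → unitInterval) (O : Finset V) (A : Set V) (D₁ D₂ : List V) :
    decoyListSet w O A (D₁ ++ D₂) = decoyListSet w O A D₁ ++ decoyListSet w O (A ∪ {d | d ∈ D₁}) D₂ := by
  induction D₁ generalizing A with
  | nil => simp
  | cons d ds ih =>
      simp only [List.cons_append, decoyListSet_cons, ih, List.cons.injEq, true_and]
      congr 2
      ext a
      simp only [Set.mem_insert_iff, Set.mem_union, Set.mem_setOf_eq, List.mem_cons]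
      tauto

/-- The decoy `d` is not among the later decoys: no head of `decoyListSet w O A ds` is `some d` when `d ∉ ds`. [folklore] -/
theorem decoyListSet_heads_ne (w : Sym2 V → unitInterval) (O : Finset V) (A : Set V) {d : V} {ds : List V} (hd : d ∉ ds) :
    ∀ dc ∈ decoyListSet w O A ds, dc.1 ≠ some d := by
  intro dc hdc h
  obtain ⟨d', hd', h'⟩ := mem_decoyListSet w O A ds dc hdc
  rw [h'] at h
  exact hd ((Option.some.inj h) ▸ hd')

end CSHSet

end Summit.CriticalPhenomena.PercolationContinuityZ3.Theorems

end
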